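import Summits.QuantumFields.YangMills.Theorems.BalabanUVNodesN11NoTLawAtAnyRegularity
import Literature.MathematicalPhysics.QuantumFieldTheory.Balaban1983to89.Node00.Record13Co

/-!
# DAG node N11 — `¬ TLaw₁₃Co θ p 0` AT EVERY STAGE-13 WITNESS: the Co RE-BASE of Record 13 (director-ym №152; def-T's `Node00/Record13Co`, background map
# `UbgOfRecord₁₃Co`) inherits the first-step negation VERBATIM — the proof of `not_hasSect2FormTAEZ_zero` never reads the background map

Cell `pub-ymgap`, YM-PLAN Track A (HUMAN RULING D-0062), seat `pub-ymgap-dag-n11-d` (g6; R134 fan-out seat N11 [B14], strategy s2), item K1⁗ `StabilityBAtRecordR13Sep`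
= stmt-QuantumFields-20290 (and its Co-keyed successor when the route is re-keyed).  [III] = [Balaban1988Convergent], [B7] = [Balaban1985Averaging].  Instances of this
seat's background-generic `…N11NoTLawAtAnyRegularity.not_hasSect2FormTAEZ_zero` at def-T's Co edition `TLaw₁₃Co` (`Record13Co.tLaw₁₃Co_iff`, `sLaw₁₃Co_zero`).

WHAT THIS FILE PROVES (0 `sorry`, 0 `def`, standard axioms).
* §0 `cubeSize_of_two_le_RkOfRecord` — the cube-size run hypothesis `2((d+5)L+3) ≤ sideχ` of all the negation theorems holds as soon as `R₁ ≥ 2`, `M₂ ≥ 1`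
  (`d = 4`, `L > 11` on the family; `R₁ ≥ (log g₁⁻²)^r` makes it automatic for small `g₁`, r ≥ 1).
* ★★★ **`not_tLaw₁₃Co_zero`** (any `θ : Stage13Params F N` with the three ζ-hypotheses), **`not_tLaw₁₃Co_zero_of_hasResidualsOfRecord`**,
  **`not_tLaw₁₃Co_zero_su2_of_hasResidualsOfRecord`**, ★★★ **`not_s1T₁₃Co_su2_of_hasResidualsOfRecord`** (the (S1ᵀ) conjunct `∀ k < K, SLaw₁₃Co → TLaw₁₃Co` is FALSE;
  `SLaw₁₃Co θ p 0` is def-T's theorem), ★★★ **`not_tLaw₁₃Co_zero_theta13LiveOfRecord`**, **`not_s1T₁₃Co_theta13LiveOfRecord_su2`** (at the witness of record, `εreg = 1`) —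
  hypotheses exactly those of the `TLaw₁₃` versions: `0 < K`, `1 ≤ M`, `1 ≤ M₂`, cube side `2((d+5)L+3) ≤ sideχ`, the [B7] Prop. 1 guard on `cR·ε₀ > 0`, the Prop. 2 guards
  on `β` with `ε₁η₁² + 8δ₀ ≤ βη₁²`, and `SU(N)` non-trivial at the two thresholds (`N = 2`: both `< 2`).  NO hypothesis on `θ.ν.εreg`.

READING (count-neutral; nothing of Bałaban asserted or refuted).  The junction defect (lit-balaban ME #15, ref-H PLACEMENT-20∕21: the 𝐓-image carries p. 256's `χreg_0`,
def-T's step weights do not) is independent of the background re-base: at every witness of the Co record too, the knit's N11 entry `hT` is unreachable; the cure is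
director-ym №146 RULING 2 (iii), ONE weight family.  K1 (∃θ) NOT refuted; N11 NOT discharged; counts unmoved (typed 28∕28 · discharged 5∕28).  One finite four-torus at
fixed `ε = L^{−K}`; NOT ℝ⁴ ∕ OS ∕ mass gap ∕ Clay.  Sources: [III] Theorem p.245, Thm 1 p.262, (2.10) p.256, (2.12)–(2.13) pp.256–257, (3.25) p.270; [B7] (10) p.19,
Prop. 1 (51) pp.25–26, Prop. 2 (52)–(54) p.26.
-/

noncomputable section

open MeasureTheory ProbabilityTheory
open scoped BigOperators Matrix.Norms.L2Operator ENNReal NNReal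

namespace Summit.QuantumFields.YangMills.Theorems.BalabanUVNodesN11NoTLawCoAtAnyRegularity

open Literature.MathematicalPhysics.QuantumFieldTheory.Balaban1983to89 T4Continuum Node00 Node00.Tk DagBinding
open Literature.MathematicalPhysics.QuantumFieldTheory.Balaban1983to89.ExpMeanLog (deltaSU)
open GaugeField (plaqHol)
open Summit.QuantumFields.YangMills.BalabanUVNodes.N07Thm1ScaledInterfaceInstance (su2_dist1_surj)
open Summit.QuantumFields.YangMills.Theorems.BalabanUVNodesN11NoTLawAtAnyRegularity

variable {F : T4Family} {N : ℕ} [NeZero N]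

/-! ## §0. The cube-size condition holds on every run whose scale-1 coupling has `R₁ ≥ 2` (e.g. `log g₁⁻² ≥ 1` at `r = 1`, n26's `log_pow_le_RkOfRecord`) -/

/-- **THE CUBE-SIZE CONDITION FROM `R₁ ≥ 2`**: on the family's tori (`d = 4`, `L > 11`), `1 ≤ M₂` and `2 ≤ R₁ = RkOfRecord L r g₁` give
`2((d+4)L + 2 + L + 1) ≤ sideχ = L²M₂R₁` — so the run hypothesis of the negation theorems holds along every run with `g₁` small (`R₁ ≥ (log g₁⁻²)^r → ∞`).
[cite: Balaban1988Convergent, (2.5) p.255, (3.2) p.265 (bookkeeping)] -/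
theorem cubeSize_of_two_le_RkOfRecord (ν : Stage7Numerics) (p : B12.RunParams) (g : ℕ → ℝ) (hM₂ : 1 ≤ ν.M₂)
    (hR : 2 ≤ RkOfRecord (F.P p.K).L ν.r (g (0 + 1))) :
    2 * ((((F.P p.K).d + 4) * (F.P p.K).L + 2) + (F.P p.K).L + 1) ≤ sideχ F ν p g 0 := by
  have hL : 12 ≤ (F.P p.K).L := by rw [T4Family.P_L]; have := F.hL11; omega
  unfold sideχ cubeSide
  rw [T4Family.P_d]
  have h1 : (F.P p.K).L ^ (0 + 1 + 1) = (F.P p.K).L * (F.P p.K).L := by ring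
  rw [h1]
  have h2 : (F.P p.K).L * (F.P p.K).L * 1 * 2 ≤ (F.P p.K).L * (F.P p.K).L * ν.M₂ * RkOfRecord (F.P p.K).L ν.r (g (0 + 1)) :=
    Nat.mul_le_mul (Nat.mul_le_mul_left _ hM₂) hR
  nlinarith [hL, h2]

/-- `R_k ≥ 2` as soon as `(log g_k⁻²)^r ≥ 2` ((2.5): `(log g⁻²)^r ≤ R_k`, def-R's `isRj_RkOfRecord`). [cite: Balaban1988Convergent, (2.5) p.255] -/
theorem two_le_RkOfRecord_of_log {L : ℕ} (hL : 2 ≤ L) (r : ℕ) (g : ℝ) (hg : 2 ≤ (Real.log (g ^ 2)⁻¹) ^ r) :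
    2 ≤ RkOfRecord L r g := by
  obtain ⟨s, -, h, -⟩ := isRj_RkOfRecord hL r g
  exact_mod_cast hg.trans h

section Negation

variable (θ : Stage13Params F N) (p : B12.RunParams)

/-- ★★★ **`¬ TLaw₁₃Co θ p 0` AT EVERY STAGE-13 WITNESS** (Co background `UbgOfRecord₁₃Co`; ζ-unity, `Σ|ζ| ≤ 1`, measurable `U`-sections; run hypotheses as in
`not_hasSect2FormTAEZ_zero`). [cite: Balaban1988Convergent, Theorem p.245, (3.25) p.270, (2.12)–(2.13) pp.256–257; Balaban1985Averaging, Prop. 1 (51) pp.25–26, Prop. 2 (52)–(54) p.26] -/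
theorem not_tLaw₁₃Co_zero (hζ : IsZetaUnity F N θ.ν θ.τ9.M θ.ζ) (hζ' : IsZetaAbsLeOne F N θ.ν θ.τ9.M θ.ζ)
    (hw : ∀ (s' : SeqOfRecord F θ.ν θ.τ9.M (gOfRecord₁₃ F N θ p) p.K 1) (V' : GaugeField (F.P p.K) 1 (SU N)),
      Measurable (fun U : GaugeField (F.P p.K) 0 (SU N) => wOfRecord F N θ.ν θ.τ9.M θ.A₁ θ.ζ p (gOfRecord₁₃ F N θ p) 0 s' U V'))
    (hK : 0 < p.K) (hMτ : 1 ≤ θ.τ9.M) (hM₂ : 1 ≤ θ.ν.M₂)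
    (hS : 2 * ((((F.P p.K).d + 4) * (F.P p.K).L + 2) + (F.P p.K).L + 1) ≤ sideχ F θ.ν p (gOfRecord₁₃ F N θ p) 0)
    (ha : 0 < θ.s2.cR * epsOfRecord θ.ν (gOfRecord₁₃ F N θ p) 0)
    (has : ((((F.P p.K).d + 4) * (F.P p.K).L : ℕ) : ℝ) ^ 2 / 4 * (θ.s2.cR * epsOfRecord θ.ν (gOfRecord₁₃ F N θ p) 0) ≤ deltaSU (Fin N) / 2)
    {β : ℝ} (hβ : 0 < β) (hβ3 : (143 * (((((F.P p.K).d + 4 : ℕ) : ℝ)) ^ 2 / 4) ^ 2) * β ≤ 1 / 3)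
    (hβ2 : 2 * β ≤ 2 * deltaSU (Fin N) / ((((F.P p.K).d + 4) * (F.P p.K).L : ℕ) : ℝ) ^ 2)
    (hβε : epsOfRecord θ.ν (gOfRecord₁₃ F N θ p) 1 * (F.P p.K).eta 1 ^ 2 + 4 * (2 * deltaOfRecord θ.ν (gOfRecord₁₃ F N θ p) 0 θ.A₁) ≤
      β * (F.P p.K).eta 1 ^ 2)
    (hg : ∃ g₀ : SU N,
      ((F.P p.K).L : ℝ) ^ 2 * (θ.s2.cR * epsOfRecord θ.ν (gOfRecord₁₃ F N θ p) 0) +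
          143 * (((((F.P p.K).d + 4) * (F.P p.K).L : ℕ) : ℝ) ^ 2 / 4 * (θ.s2.cR * epsOfRecord θ.ν (gOfRecord₁₃ F N θ p) 0)) ^ 2 < dist1 g₀ ∧
        2 * β < dist1 g₀) :
    ¬ TLaw₁₃Co F N θ p 0 := fun hT =>
  not_hasSect2FormTAEZ_zero θ p _ hζ hζ' hw hK hMτ hM₂ hS ha has hβ hβ3 hβ2 hβε hg ((tLaw₁₃Co_iff F N θ p 0).mp hT)

/-- … for a witness carrying K0b's residuals of record. [cite: Balaban1988Convergent, Theorem p.245, (3.25) p.270, (3.16) p.268; Balaban1985Averaging, Prop. 1 (51) pp.25–26, Prop. 2 (52)–(54) p.26] -/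
theorem not_tLaw₁₃Co_zero_of_hasResidualsOfRecord (hres : θ.HasResidualsOfRecord F N)
    (hK : 0 < p.K) (hMτ : 1 ≤ θ.τ9.M) (hM₂ : 1 ≤ θ.ν.M₂)
    (hS : 2 * ((((F.P p.K).d + 4) * (F.P p.K).L + 2) + (F.P p.K).L + 1) ≤ sideχ F θ.ν p (gOfRecord₁₃ F N θ p) 0)
    (ha : 0 < θ.s2.cR * epsOfRecord θ.ν (gOfRecord₁₃ F N θ p) 0)
    (has : ((((F.P p.K).d + 4) * (F.P p.K).L : ℕ) : ℝ) ^ 2 / 4 * (θ.s2.cR * epsOfRecord θ.ν (gOfRecord₁₃ F N θ p) 0) ≤ deltaSU (Fin N) / 2)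
    {β : ℝ} (hβ : 0 < β) (hβ3 : (143 * (((((F.P p.K).d + 4 : ℕ) : ℝ)) ^ 2 / 4) ^ 2) * β ≤ 1 / 3)
    (hβ2 : 2 * β ≤ 2 * deltaSU (Fin N) / ((((F.P p.K).d + 4) * (F.P p.K).L : ℕ) : ℝ) ^ 2)
    (hβε : epsOfRecord θ.ν (gOfRecord₁₃ F N θ p) 1 * (F.P p.K).eta 1 ^ 2 + 4 * (2 * deltaOfRecord θ.ν (gOfRecord₁₃ F N θ p) 0 θ.A₁) ≤
      β * (F.P p.K).eta 1 ^ 2)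
    (hg : ∃ g₀ : SU N,
      ((F.P p.K).L : ℝ) ^ 2 * (θ.s2.cR * epsOfRecord θ.ν (gOfRecord₁₃ F N θ p) 0) +
          143 * (((((F.P p.K).d + 4) * (F.P p.K).L : ℕ) : ℝ) ^ 2 / 4 * (θ.s2.cR * epsOfRecord θ.ν (gOfRecord₁₃ F N θ p) 0)) ^ 2 < dist1 g₀ ∧
        2 * β < dist1 g₀) :
    ¬ TLaw₁₃Co F N θ p 0 := by
  refine not_tLaw₁₃Co_zero θ p hres.zetaUnity hres.zetaAbs (fun s' V' => ?_) hK hMτ hM₂ hS ha has hβ hβ3 hβ2 hβε hg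
  rw [hres.zeta_eq]
  exact measurable_wOfRecord_zeta316_section θ.A₁ s' V'

/-- ★★★ **AT `SU(2)`: the (S1ᵀ) conjunct `∀ k < K, SLaw₁₃Co θ p k → TLaw₁₃Co θ p k` of rung 1 at the Co record is FALSE** at every `θ : Stage13Params F 2` with K0b's
residuals, on every run with `0 < K` meeting the cube-size and the two small-parameter conditions (`SLaw₁₃Co θ p 0` is def-T's theorem `sLaw₁₃Co_zero`; n07-e's element at
distance `2`). [cite: Balaban1988Convergent, Theorem p.245, Thm 1 p.262, (3.25) p.270; Balaban1985Averaging, Prop. 1 (51) pp.25–26, Prop. 2 (52)–(54) p.26] -/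
theorem not_s1T₁₃Co_su2_of_hasResidualsOfRecord {F : T4Family} (θ : Stage13Params F 2) (p : B12.RunParams) (hres : θ.HasResidualsOfRecord F 2)
    (hK : 0 < p.K) (hMτ : 1 ≤ θ.τ9.M) (hM₂ : 1 ≤ θ.ν.M₂)
    (hS : 2 * ((((F.P p.K).d + 4) * (F.P p.K).L + 2) + (F.P p.K).L + 1) ≤ sideχ F θ.ν p (gOfRecord₁₃ F 2 θ p) 0)
    (ha : 0 < θ.s2.cR * epsOfRecord θ.ν (gOfRecord₁₃ F 2 θ p) 0)
    (has : ((((F.P p.K).d + 4) * (F.P p.K).L : ℕ) : ℝ) ^ 2 / 4 * (θ.s2.cR * epsOfRecord θ.ν (gOfRecord₁₃ F 2 θ p) 0) ≤ deltaSU (Fin 2) / 2)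
    {β : ℝ} (hβ : 0 < β) (hβ3 : (143 * (((((F.P p.K).d + 4 : ℕ) : ℝ)) ^ 2 / 4) ^ 2) * β ≤ 1 / 3)
    (hβ2 : 2 * β ≤ 2 * deltaSU (Fin 2) / ((((F.P p.K).d + 4) * (F.P p.K).L : ℕ) : ℝ) ^ 2)
    (hβε : epsOfRecord θ.ν (gOfRecord₁₃ F 2 θ p) 1 * (F.P p.K).eta 1 ^ 2 + 4 * (2 * deltaOfRecord θ.ν (gOfRecord₁₃ F 2 θ p) 0 θ.A₁) ≤
      β * (F.P p.K).eta 1 ^ 2)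
    (ha2 : ((F.P p.K).L : ℝ) ^ 2 * (θ.s2.cR * epsOfRecord θ.ν (gOfRecord₁₃ F 2 θ p) 0) +
      143 * (((((F.P p.K).d + 4) * (F.P p.K).L : ℕ) : ℝ) ^ 2 / 4 * (θ.s2.cR * epsOfRecord θ.ν (gOfRecord₁₃ F 2 θ p) 0)) ^ 2 < 2) :
    ¬ (∀ k, k < p.K → SLaw₁₃Co F 2 θ p k → TLaw₁₃Co F 2 θ p k) := by
  intro h
  obtain ⟨g₀, hg₀⟩ := su2_dist1_surj 2 zero_le_two le_rfl
  have hd : (F.P p.K).d = 4 := rfl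
  have hβlt : 2 * β < 2 := by
    rw [hd] at hβ3
    norm_num at hβ3
    linarith
  exact not_tLaw₁₃Co_zero_of_hasResidualsOfRecord θ p hres hK hMτ hM₂ hS ha has hβ hβ3 hβ2 hβε
    ⟨g₀, by rw [hg₀]; exact ha2, by rw [hg₀]; exact hβlt⟩ (h 0 hK (sLaw₁₃Co_zero F 2 θ p))

end Negation

section AtRecord

variable (F N)

/-- ★★★ **AT THE WITNESS OF RECORD `theta13LiveOfRecord` (`εreg = 1`): `¬ TLaw₁₃Co F N θ_live p 0`** on every run with `0 < K`, the cube-size condition, the Prop-1 guard on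
`ε₀(g₀)`, the Prop-2 guards on `β`, and `SU(N)` non-trivial at the two thresholds. [cite: Balaban1988Convergent, Theorem p.245, (3.25) p.270, (2.10) p.256; Balaban1985Averaging, Prop. 1 (51) pp.25–26, Prop. 2 (52)–(54) p.26] -/
theorem not_tLaw₁₃Co_zero_theta13LiveOfRecord (p : B12.RunParams) (hK : 0 < p.K)
    (hS : 2 * ((((F.P p.K).d + 4) * (F.P p.K).L + 2) + (F.P p.K).L + 1) ≤
      sideχ F (theta13LiveOfRecord F N).ν p (gOfRecord₁₃ F N (theta13LiveOfRecord F N) p) 0)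
    (ha : 0 < epsOfRecord (theta13LiveOfRecord F N).ν (gOfRecord₁₃ F N (theta13LiveOfRecord F N) p) 0)
    (has : ((((F.P p.K).d + 4) * (F.P p.K).L : ℕ) : ℝ) ^ 2 / 4 * epsOfRecord (theta13LiveOfRecord F N).ν (gOfRecord₁₃ F N (theta13LiveOfRecord F N) p) 0 ≤
      deltaSU (Fin N) / 2)
    {β : ℝ} (hβ : 0 < β) (hβ3 : (143 * (((((F.P p.K).d + 4 : ℕ) : ℝ)) ^ 2 / 4) ^ 2) * β ≤ 1 / 3)
    (hβ2 : 2 * β ≤ 2 * deltaSU (Fin N) / ((((F.P p.K).d + 4) * (F.P p.K).L : ℕ) : ℝ) ^ 2)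
    (hβε : epsOfRecord (theta13LiveOfRecord F N).ν (gOfRecord₁₃ F N (theta13LiveOfRecord F N) p) 1 * (F.P p.K).eta 1 ^ 2 +
        4 * (2 * deltaOfRecord (theta13LiveOfRecord F N).ν (gOfRecord₁₃ F N (theta13LiveOfRecord F N) p) 0 (theta13LiveOfRecord F N).A₁) ≤
      β * (F.P p.K).eta 1 ^ 2)
    (hg : ∃ g₀ : SU N,
      ((F.P p.K).L : ℝ) ^ 2 * epsOfRecord (theta13LiveOfRecord F N).ν (gOfRecord₁₃ F N (theta13LiveOfRecord F N) p) 0 +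
          143 * (((((F.P p.K).d + 4) * (F.P p.K).L : ℕ) : ℝ) ^ 2 / 4 *
            epsOfRecord (theta13LiveOfRecord F N).ν (gOfRecord₁₃ F N (theta13LiveOfRecord F N) p) 0) ^ 2 < dist1 g₀ ∧
        2 * β < dist1 g₀) :
    ¬ TLaw₁₃Co F N (theta13LiveOfRecord F N) p 0 := by
  have h1 : (theta13LiveOfRecord F N).s2.cR * epsOfRecord (theta13LiveOfRecord F N).ν (gOfRecord₁₃ F N (theta13LiveOfRecord F N) p) 0 =
      epsOfRecord (theta13LiveOfRecord F N).ν (gOfRecord₁₃ F N (theta13LiveOfRecord F N) p) 0 := by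
    rw [cR_theta13LiveOfRecord, one_mul]
  refine not_tLaw₁₃Co_zero_of_hasResidualsOfRecord _ p (hasResidualsOfRecord_theta13LiveOfRecord F N) hK
    (Summit.QuantumFields.YangMills.Theorems.BalabanUVNodesN11NoExpansionTermFree.one_le_M_theta13LiveOfFamily F N eps0OfRecord₁₃ _ _ (ZtOfRecord F N))
    le_rfl hS (by rw [h1]; exact ha) (by rw [h1]; exact has) hβ hβ3 hβ2 hβε ?_
  rw [h1]
  exact hg

/-- ★★★ **AT `SU(2)`, AT THE WITNESS OF RECORD: rung 1's N11 conjunct over the Co record, `∀ k < K, SLaw₁₃Co → TLaw₁₃Co`, is FALSE at `theta13LiveOfRecord F 2`** on every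
run with `0 < K` meeting the cube-size condition and the two small-parameter guards. [cite: Balaban1988Convergent, Theorem p.245, Thm 1 p.262, (3.25) p.270; Balaban1985Averaging, Prop. 1 (51) pp.25–26, Prop. 2 (52)–(54) p.26] -/
theorem not_s1T₁₃Co_theta13LiveOfRecord_su2 {F : T4Family} (p : B12.RunParams) (hK : 0 < p.K)
    (hS : 2 * ((((F.P p.K).d + 4) * (F.P p.K).L + 2) + (F.P p.K).L + 1) ≤
      sideχ F (theta13LiveOfRecord F 2).ν p (gOfRecord₁₃ F 2 (theta13LiveOfRecord F 2) p) 0)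
    (ha : 0 < epsOfRecord (theta13LiveOfRecord F 2).ν (gOfRecord₁₃ F 2 (theta13LiveOfRecord F 2) p) 0)
    (has : ((((F.P p.K).d + 4) * (F.P p.K).L : ℕ) : ℝ) ^ 2 / 4 * epsOfRecord (theta13LiveOfRecord F 2).ν (gOfRecord₁₃ F 2 (theta13LiveOfRecord F 2) p) 0 ≤
      deltaSU (Fin 2) / 2)
    (ha2 : ((F.P p.K).L : ℝ) ^ 2 * epsOfRecord (theta13LiveOfRecord F 2).ν (gOfRecord₁₃ F 2 (theta13LiveOfRecord F 2) p) 0 +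
        143 * (((((F.P p.K).d + 4) * (F.P p.K).L : ℕ) : ℝ) ^ 2 / 4 *
          epsOfRecord (theta13LiveOfRecord F 2).ν (gOfRecord₁₃ F 2 (theta13LiveOfRecord F 2) p) 0) ^ 2 < 2)
    {β : ℝ} (hβ : 0 < β) (hβ3 : (143 * (((((F.P p.K).d + 4 : ℕ) : ℝ)) ^ 2 / 4) ^ 2) * β ≤ 1 / 3)
    (hβ2 : 2 * β ≤ 2 * deltaSU (Fin 2) / ((((F.P p.K).d + 4) * (F.P p.K).L : ℕ) : ℝ) ^ 2)
    (hβε : epsOfRecord (theta13LiveOfRecord F 2).ν (gOfRecord₁₃ F 2 (theta13LiveOfRecord F 2) p) 1 * (F.P p.K).eta 1 ^ 2 +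
        4 * (2 * deltaOfRecord (theta13LiveOfRecord F 2).ν (gOfRecord₁₃ F 2 (theta13LiveOfRecord F 2) p) 0 (theta13LiveOfRecord F 2).A₁) ≤
      β * (F.P p.K).eta 1 ^ 2) :
    ¬ (∀ k, k < p.K → SLaw₁₃Co F 2 (theta13LiveOfRecord F 2) p k → TLaw₁₃Co F 2 (theta13LiveOfRecord F 2) p k) := by
  intro h
  obtain ⟨g₀, hg₀⟩ := su2_dist1_surj 2 zero_le_two le_rfl
  have hd : (F.P p.K).d = 4 := rfl
  have hβlt : 2 * β < 2 := by
    rw [hd] at hβ3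
    norm_num at hβ3
    linarith
  exact not_tLaw₁₃Co_zero_theta13LiveOfRecord F 2 p hK hS ha has hβ hβ3 hβ2 hβε ⟨g₀, by rw [hg₀]; exact ha2, by rw [hg₀]; exact hβlt⟩
    (h 0 hK (sLaw₁₃Co_zero F 2 _ p))

end AtRecord

end Summit.QuantumFields.YangMills.Theorems.BalabanUVNodesN11NoTLawCoAtAnyRegularity

end
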